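import Mathlib
import HarnessLib
import Summits.ValiantsHypothesis.ValiantsHypothesis.Theorems.LacunarySymmetroidMatrixDescartesOsculationLawRankOneColumn

/-!
# ValiantsHypothesis / LacunarySymmetroid — crux `MatrixDescartes` (stmt-ValiantsHypothesis-18050, V1),
# line `Cruxes/MatrixDescartes/Lines/osculation_law.lean` («osculation-law»): the RANK-TWO LETTER as a quadratic in `b`

Determinant bookkeeping for the `(2, s)` splittings of the osculation law (a rank-two semidefinite letter
`b·(I₂ ⊕ 0)` inserted into a pencil of any size `s + 2`): over any commutative ring,

  `det(G + b·(I₂ ⊕ 0)) = det G₂₂ · b² + (det G[row inl 0 := e₀] + det G[row inl 1 := e₁]) · b + det G`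

(`det_add_smul_blockProj_two`; the two middle determinants are the diagonal cofactors `adj G (inl i) (inl i)`,
`Matrix.adjugate_apply`), by two row-linearity steps (`Matrix.det_updateRow_add/smul`) and the block-triangular
determinant `det [[I₂, 0], [G₂₁, G₂₂]] = det G₂₂`.  Honest framing: bookkeeping only; nothing here bears on
`OsculationLaw`, `MatrixDescartes`, Conjecture B or `VP ≠ VNP`.  No definitions, no named facts; Mathlib only.
-/

-- `Summit.ValiantsHypothesis.ValiantsHypothesis.…` is the tree's mandated single-conjunct layout (Sub = Summit).
set_option linter.dupNamespace false

namespace Summit.ValiantsHypothesis.ValiantsHypothesis.Theorems.LacunarySymmetroidMatrixDescartes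

namespace OsculationRankTwo

variable {R : Type*} [CommRing R] {s : ℕ}

/-- `G + b·(I₂ ⊕ 0)` as two successive row updates `row (inl i) += b·e_(inl i)`. [folklore] -/
theorem add_smul_blockProj_eq (G : Matrix (Fin 2 ⊕ Fin s) (Fin 2 ⊕ Fin s) R) (b : R) :
    G + b • (Matrix.fromBlocks 1 0 0 0 : Matrix (Fin 2 ⊕ Fin s) (Fin 2 ⊕ Fin s) R) =
      (G.updateRow (Sum.inl 0) (G (Sum.inl 0) + b • (Pi.single (Sum.inl 0) 1 : Fin 2 ⊕ Fin s → R))).updateRow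
        (Sum.inl 1) (G (Sum.inl 1) + b • (Pi.single (Sum.inl 1) 1 : Fin 2 ⊕ Fin s → R)) := by
  ext i j
  simp only [Matrix.add_apply, Matrix.smul_apply, Matrix.updateRow_apply, smul_eq_mul, Pi.add_apply,
    Pi.smul_apply]
  rcases i with i | i <;> rcases j with j | j
  · fin_cases i <;> fin_cases j <;> simp [Matrix.fromBlocks_apply₁₁]
  · fin_cases i <;> simp [Matrix.fromBlocks_apply₁₂]
  · simp [Matrix.fromBlocks_apply₂₁]
  · simp [Matrix.fromBlocks_apply₂₂]

/-- Replacing both `inl` rows by unit vectors leaves the block-triangular matrix `[[I₂, 0], [G₂₁, G₂₂]]`. [folklore] -/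
theorem updateRow_updateRow_eq_fromBlocks (G : Matrix (Fin 2 ⊕ Fin s) (Fin 2 ⊕ Fin s) R) :
    (G.updateRow (Sum.inl 1) (Pi.single (Sum.inl 1) 1 : Fin 2 ⊕ Fin s → R)).updateRow (Sum.inl 0)
        (Pi.single (Sum.inl 0) 1 : Fin 2 ⊕ Fin s → R) =
      Matrix.fromBlocks 1 0 G.toBlocks₂₁ G.toBlocks₂₂ := by
  ext i j
  rcases i with i | i <;> rcases j with j | j
  · fin_cases i <;> fin_cases j <;>
      simp [Matrix.updateRow_apply, Matrix.fromBlocks_apply₁₁]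
  · fin_cases i <;> simp [Matrix.updateRow_apply, Matrix.fromBlocks_apply₁₂]
  · simp [Matrix.updateRow_apply, Matrix.fromBlocks_apply₂₁, Matrix.toBlocks₂₁]
  · simp [Matrix.updateRow_apply, Matrix.fromBlocks_apply₂₂, Matrix.toBlocks₂₂]

/-- **The rank-two letter is a quadratic in `b`**:
`det(G + b·(I₂ ⊕ 0)) = det G₂₂ · b² + (det G[inl 0 := e₀] + det G[inl 1 := e₁]) · b + det G`. [folklore] -/
theorem det_add_smul_blockProj_two (G : Matrix (Fin 2 ⊕ Fin s) (Fin 2 ⊕ Fin s) R) (b : R) :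
    (G + b • (Matrix.fromBlocks 1 0 0 0 : Matrix (Fin 2 ⊕ Fin s) (Fin 2 ⊕ Fin s) R)).det =
      b * b * G.toBlocks₂₂.det
        + b * ((G.updateRow (Sum.inl 0) (Pi.single (Sum.inl 0) 1 : Fin 2 ⊕ Fin s → R)).det
          + (G.updateRow (Sum.inl 1) (Pi.single (Sum.inl 1) 1 : Fin 2 ⊕ Fin s → R)).det)
        + G.det := by
  have hne : (Sum.inl 0 : Fin 2 ⊕ Fin s) ≠ Sum.inl 1 := by simp
  rw [add_smul_blockProj_eq, Matrix.det_updateRow_add, Matrix.det_updateRow_smul]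
  have h1 : (G.updateRow (Sum.inl 0) (G (Sum.inl 0) + b • (Pi.single (Sum.inl 0) 1 : Fin 2 ⊕ Fin s → R))).updateRow
      (Sum.inl 1) (G (Sum.inl 1)) =
      G.updateRow (Sum.inl 0) (G (Sum.inl 0) + b • (Pi.single (Sum.inl 0) 1 : Fin 2 ⊕ Fin s → R)) := by
    have e : G (Sum.inl 1) = (G.updateRow (Sum.inl 0)
        (G (Sum.inl 0) + b • (Pi.single (Sum.inl 0) 1 : Fin 2 ⊕ Fin s → R))) (Sum.inl 1) :=
      (Matrix.updateRow_ne hne.symm).symm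
    conv_lhs => rw [e]
    exact Matrix.updateRow_eq_self _ _
  have h2 : (G.updateRow (Sum.inl 1) (Pi.single (Sum.inl 1) 1 : Fin 2 ⊕ Fin s → R)).updateRow (Sum.inl 0)
      (G (Sum.inl 0)) = G.updateRow (Sum.inl 1) (Pi.single (Sum.inl 1) 1 : Fin 2 ⊕ Fin s → R) := by
    have e : G (Sum.inl 0) = (G.updateRow (Sum.inl 1) (Pi.single (Sum.inl 1) 1 : Fin 2 ⊕ Fin s → R)) (Sum.inl 0) :=
      (Matrix.updateRow_ne hne).symm
    conv_lhs => rw [e]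
    exact Matrix.updateRow_eq_self _ _
  rw [h1, Matrix.det_updateRow_add, Matrix.det_updateRow_smul, Matrix.updateRow_eq_self,
    Matrix.updateRow_comm _ hne, Matrix.det_updateRow_add, Matrix.det_updateRow_smul, h2,
    updateRow_updateRow_eq_fromBlocks, Matrix.det_fromBlocks_zero₁₂, Matrix.det_one, one_mul]
  ring

/-! ### The rank-two letter inserted into a pencil: `Φ = X₁X₁·ι a + X₁·ι m + ι δ` -/

section pencil

open Polynomial
open scoped BigOperators

/-- The lower-right block of a block pencil is the pencil of the lower-right blocks. [folklore] -/
theorem toBlocks₂₂_pencil {K : ℕ} (d : Fin K → ℕ) (S : Fin K → Matrix (Fin 2 ⊕ Fin s) (Fin 2 ⊕ Fin s) ℝ) :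
    (∑ l, (X : ℝ[X]) ^ d l • (S l).map Polynomial.C).toBlocks₂₂ = (∑ l, (X : ℝ[X]) ^ d l • ((S l).toBlocks₂₂).map Polynomial.C) := by
  ext i j
  simp only [Matrix.toBlocks₂₂, Matrix.of_apply, Matrix.sum_apply, Matrix.smul_apply, Matrix.map_apply]

/-- A map fixing `0` and `1` maps a unit row to a unit row. [folklore] -/
theorem comp_single_one {ι A B : Type*} [DecidableEq ι] [Zero A] [One A] [Zero B] [One B] {f : A → B}
    (h0 : f 0 = 0) (h1 : f 1 = 1) (i : ι) : (f ∘ (Pi.single i 1 : ι → A)) = (Pi.single i 1 : ι → B) := by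
  funext j
  rcases eq_or_ne j i with rfl | h
  · simp [h1]
  · simp [h, h0]

/-- The block projector survives the coefficient embedding. [folklore] -/
theorem blockProj_map {A B : Type*} [Zero A] [One A] [Zero B] [One B] {f : A → B} (h0 : f 0 = 0) (h1 : f 1 = 1) :
    (Matrix.fromBlocks 1 0 0 0 : Matrix (Fin 2 ⊕ Fin s) (Fin 2 ⊕ Fin s) A).map f =
      (Matrix.fromBlocks 1 0 0 0 : Matrix (Fin 2 ⊕ Fin s) (Fin 2 ⊕ Fin s) B) := by
  rw [Matrix.fromBlocks_map, Matrix.map_one f h0 h1, Matrix.map_zero f h0, Matrix.map_zero f h0,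
    Matrix.map_zero f h0]

/-- **The insertion polynomial at `(2, s)`**: `det(Σ_l X₀^(d l) S_l + X₁·(I₂ ⊕ 0)) = X₁X₁·ι a + X₁·ι m + ι δ` with
`a = det G₂₂` (the pencil of the lower-right blocks), `m = det G[inl 0 := e₀] + det G[inl 1 := e₁]` (the two diagonal
cofactors), `δ = det G`, `ι : X ↦ X₀`. [folklore] -/
theorem insertionPoly_two {K : ℕ} (d : Fin K → ℕ) (S : Fin K → Matrix (Fin 2 ⊕ Fin s) (Fin 2 ⊕ Fin s) ℝ) :
    (∑ l, (MvPolynomial.X (0 : Fin 2) : MvPolynomial (Fin 2) ℝ) ^ d l •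
              (S l).map (MvPolynomial.C : ℝ →+* MvPolynomial (Fin 2) ℝ)
            + (MvPolynomial.X (1 : Fin 2) : MvPolynomial (Fin 2) ℝ) •
              (Matrix.fromBlocks 1 0 0 0 : Matrix (Fin 2 ⊕ Fin s) (Fin 2 ⊕ Fin s) ℝ).map
                (MvPolynomial.C : ℝ →+* MvPolynomial (Fin 2) ℝ)).det =
      MvPolynomial.X 1 * MvPolynomial.X 1 * Polynomial.aeval (MvPolynomial.X 0 : MvPolynomial (Fin 2) ℝ) (∑ l, (X : ℝ[X]) ^ d l • ((S l).toBlocks₂₂).map Polynomial.C).det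
        + MvPolynomial.X 1 * Polynomial.aeval (MvPolynomial.X 0 : MvPolynomial (Fin 2) ℝ)
            (((∑ l, (X : ℝ[X]) ^ d l • (S l).map Polynomial.C).updateRow (Sum.inl 0) (Pi.single (Sum.inl 0) 1 : Fin 2 ⊕ Fin s → ℝ[X])).det
              + ((∑ l, (X : ℝ[X]) ^ d l • (S l).map Polynomial.C).updateRow (Sum.inl 1) (Pi.single (Sum.inl 1) 1 : Fin 2 ⊕ Fin s → ℝ[X])).det)
        + Polynomial.aeval (MvPolynomial.X 0 : MvPolynomial (Fin 2) ℝ) (∑ l, (X : ℝ[X]) ^ d l • (S l).map Polynomial.C).det := by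
  rw [← OsculationTwoK.map_aevalX0_pencil_gen d S, blockProj_map (map_zero _) (map_one _),
    det_add_smul_blockProj_two, map_add]
  simp only [AlgHom.map_det, AlgHom.mapMatrix_apply, Matrix.map_updateRow,
    comp_single_one (map_zero _) (map_one _), ← toBlocks₂₂_pencil]
  rfl

end pencil

/-! ### Monomial bookkeeping for the diagonal cofactors: `supp det G[i₀ := e_(i₀)] ⊆ (n − 1) • E` -/

section support

open Polynomial
open scoped BigOperators Pointwise

/-- A unit-row entry is a constant: its support lies in `0 • E = {0}`. [folklore] -/
theorem supp_single_apply {ι : Type*} [DecidableEq ι] (E : Finset ℕ) (i₀ j : ι) :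
    ((Pi.single i₀ 1 : ι → ℝ[X]) j).support ⊆ 0 • E := by
  rw [zero_nsmul, ← Finset.singleton_zero]
  rcases eq_or_ne j i₀ with rfl | h
  · rw [Pi.single_eq_same, ← C_1]; exact support_C_subset _
  · rw [Pi.single_eq_of_ne h, support_zero]; exact Finset.empty_subset _

/-- Leibniz with one constant row: the exponents of `det` of an `n × n` pencil with row `i₀` replaced by the unit
vector `e_(i₀)` (the diagonal cofactor) lie in the `(n − 1)`-fold sumset of its exponent set. [folklore] -/
theorem supp_det_updateRow_single {ι : Type*} [Fintype ι] [DecidableEq ι] {K : ℕ} (d : Fin K → ℕ)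
    (T : Fin K → Matrix ι ι ℝ) (i₀ : ι) :
    (((∑ l, (X : ℝ[X]) ^ d l • (T l).map Polynomial.C).updateRow i₀ (Pi.single i₀ 1 : ι → ℝ[X])).det).support ⊆
      (Fintype.card ι - 1) • Finset.univ.image d := by
  classical
  rw [Matrix.det_apply']
  refine OsculationTwoK.supp_sum _ _ fun σ _ => OsculationTwoK.supp_intCast_mul _ ?_
  have hj₀ : σ.symm i₀ ∈ Finset.univ := Finset.mem_univ _
  rw [← Finset.mul_prod_erase _ _ hj₀, Equiv.apply_symm_apply, Matrix.updateRow_self]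
  have hrest : (∏ x ∈ Finset.univ.erase (σ.symm i₀),
      ((∑ l, (X : ℝ[X]) ^ d l • (T l).map Polynomial.C).updateRow i₀ (Pi.single i₀ 1 : ι → ℝ[X])) (σ x) x).support ⊆
      ((Finset.univ.erase (σ.symm i₀)).card * 1) • Finset.univ.image d := by
    refine OsculationTwoK.supp_prod _ _ fun x hx => ?_
    have hx' : σ x ≠ i₀ := by
      intro h
      exact (Finset.mem_erase.1 hx).1 (by rw [← h, Equiv.symm_apply_apply])
    rw [Matrix.updateRow_ne hx']
    exact OsculationTwoK.support_pencil_apply d T (σ x) x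
  refine OsculationCusp.supp_cast (OsculationCusp.supp_mul (supp_single_apply _ i₀ (σ.symm i₀)) hrest) ?_
  rw [Finset.card_erase_of_mem hj₀, Finset.card_univ]
  ring

end support

/-! ### Real-rootedness of the rank-two letter for symmetric matrices -/

section disc

/-- **Symmetric rank-two letters are real-rooted.**  For a real symmetric `G` on `Fin 2 ⊕ Fin s`, the quadratic
`det(G + b·(I₂ ⊕ 0)) = a b² + m b + δ` of `det_add_smul_blockProj_two` has `4aδ ≤ m²`: if `a = det G₂₂ ≠ 0` the Schur
complement `Σ = G₁₁ − G₁₂ G₂₂⁻¹ G₂₁` is a symmetric `2 × 2` matrix with `det(G + bP) = a·det(Σ + bI₂)`, whose discriminant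
is `(Σ₀₀ − Σ₁₁)² + 4Σ₀₁²`; if `a = 0` the claim is `0 ≤ m²`. [folklore] -/
theorem disc_nonneg_real (G : Matrix (Fin 2 ⊕ Fin s) (Fin 2 ⊕ Fin s) ℝ) (hG : G.IsSymm) :
    4 * (G.toBlocks₂₂.det * G.det) ≤
      ((G.updateRow (Sum.inl 0) (Pi.single (Sum.inl 0) 1 : Fin 2 ⊕ Fin s → ℝ)).det
        + (G.updateRow (Sum.inl 1) (Pi.single (Sum.inl 1) 1 : Fin 2 ⊕ Fin s → ℝ)).det) ^ 2 := by
  set a := G.toBlocks₂₂.det with ha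
  set m := (G.updateRow (Sum.inl 0) (Pi.single (Sum.inl 0) 1 : Fin 2 ⊕ Fin s → ℝ)).det
        + (G.updateRow (Sum.inl 1) (Pi.single (Sum.inl 1) 1 : Fin 2 ⊕ Fin s → ℝ)).det with hm
  set δ := G.det with hδ
  by_cases ha0 : a = 0
  · rw [ha0, zero_mul, mul_zero]; exact sq_nonneg _
  -- the quadratic in two ways: row expansion and Schur complement
  have hquad : ∀ b : ℝ, (G + b • (Matrix.fromBlocks 1 0 0 0 : Matrix (Fin 2 ⊕ Fin s) (Fin 2 ⊕ Fin s) ℝ)).det =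
      b * b * a + b * m + δ := fun b => det_add_smul_blockProj_two G b
  haveI : Invertible G.toBlocks₂₂ := Matrix.invertibleOfIsUnitDet _ (Ne.isUnit ha0)
  set Sc : Matrix (Fin 2) (Fin 2) ℝ := G.toBlocks₁₁ - G.toBlocks₁₂ * ⅟G.toBlocks₂₂ * G.toBlocks₂₁ with hSc
  have hschur : ∀ b : ℝ, (G + b • (Matrix.fromBlocks 1 0 0 0 : Matrix (Fin 2 ⊕ Fin s) (Fin 2 ⊕ Fin s) ℝ)).det =
      a * ((Sc 0 0 + b) * (Sc 1 1 + b) - Sc 0 1 * Sc 1 0) := by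
    intro b
    have hGb : G + b • (Matrix.fromBlocks 1 0 0 0 : Matrix (Fin 2 ⊕ Fin s) (Fin 2 ⊕ Fin s) ℝ) =
        Matrix.fromBlocks (G.toBlocks₁₁ + b • 1) G.toBlocks₁₂ G.toBlocks₂₁ G.toBlocks₂₂ := by
      conv_lhs => rw [← Matrix.fromBlocks_toBlocks G]
      rw [Matrix.fromBlocks_smul, Matrix.fromBlocks_add, smul_zero, smul_zero, smul_zero, add_zero, add_zero, add_zero]
    rw [hGb, Matrix.det_fromBlocks₂₂, Matrix.det_fin_two]
    have hS : G.toBlocks₁₁ + b • 1 - G.toBlocks₁₂ * ⅟G.toBlocks₂₂ * G.toBlocks₂₁ = Sc + b • 1 := by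
      rw [hSc]; abel
    rw [hS]
    simp only [Matrix.add_apply, Matrix.smul_apply, Matrix.one_apply_eq,
      Matrix.one_apply_ne (show (0 : Fin 2) ≠ 1 by decide), Matrix.one_apply_ne (show (1 : Fin 2) ≠ 0 by decide),
      smul_eq_mul, mul_one, mul_zero, add_zero]
    ring
  -- symmetry of the Schur complement
  have hsym : Sc 0 1 = Sc 1 0 := by
    have h11 : G.toBlocks₁₁.transpose = G.toBlocks₁₁ := by
      ext i j; exact hG.apply (Sum.inl i) (Sum.inl j)
    have h12 : G.toBlocks₁₂.transpose = G.toBlocks₂₁ := by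
      ext i j; exact hG.apply (Sum.inr i) (Sum.inl j)
    have h21 : G.toBlocks₂₁.transpose = G.toBlocks₁₂ := by
      ext i j; exact hG.apply (Sum.inl i) (Sum.inr j)
    have h22 : G.toBlocks₂₂.transpose = G.toBlocks₂₂ := by
      ext i j; exact hG.apply (Sum.inr i) (Sum.inr j)
    have hinv : (⅟G.toBlocks₂₂).transpose = ⅟G.toBlocks₂₂ := by
      rw [Matrix.invOf_eq_nonsing_inv, Matrix.transpose_nonsing_inv, h22]
    have hSct : Sc.transpose = Sc := by
      rw [hSc, Matrix.transpose_sub, Matrix.transpose_mul, Matrix.transpose_mul, h11, h12, h21, hinv,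
        Matrix.mul_assoc]
    have := congr_fun (congr_fun hSct 1) 0
    rwa [Matrix.transpose_apply] at this
  -- compare coefficients at `b = 0` and `b = 1`
  have h0 := (hquad 0).symm.trans (hschur 0)
  have h1 := (hquad 1).symm.trans (hschur 1)
  have hδ' : δ = a * (Sc 0 0 * Sc 1 1 - Sc 0 1 * Sc 1 0) := by linarith
  have hm' : m = a * (Sc 0 0 + Sc 1 1) := by nlinarith
  rw [hδ', hm', hsym]
  nlinarith [sq_nonneg (a * (Sc 0 0 - Sc 1 1)), sq_nonneg (a * Sc 1 0)]

end disc

/-! ### The pencil version: `4·a(t)·δ(t) ≤ m(t)²` for symmetric block pencils -/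

section pencilDisc

open Polynomial
open scoped BigOperators

/-- A pencil of symmetric matrices is a symmetric polynomial matrix. [folklore] -/
theorem pencil_isSymm {ι : Type*} [Fintype ι] [DecidableEq ι] {K : ℕ} (d : Fin K → ℕ) (T : Fin K → Matrix ι ι ℝ)
    (hT : ∀ l, (T l).IsSymm) : (∑ l, (X : ℝ[X]) ^ d l • (T l).map Polynomial.C).IsSymm := by
  refine Matrix.IsSymm.ext fun i j => ?_
  rw [OsculationTwoK.pencil_apply, OsculationTwoK.pencil_apply]
  exact Finset.sum_congr rfl fun l _ => by rw [(hT l).apply i j]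

/-- **Real-rootedness of the `(2, s)` letter**: for a symmetric block pencil, the coefficients `a = det G₂₂`,
`m = det G[inl 0 := e₀] + det G[inl 1 := e₁]`, `δ = det G` of `insertionPoly_two` satisfy `4·a(t)·δ(t) ≤ m(t)²` for
every real `t` (`disc_nonneg_real` at the evaluated matrix `G(t)`). [folklore] -/
theorem hdisc_two {K : ℕ} (d : Fin K → ℕ) (S : Fin K → Matrix (Fin 2 ⊕ Fin s) (Fin 2 ⊕ Fin s) ℝ)
    (hS : ∀ l, (S l).IsSymm) (t : ℝ) :
    4 * (((∑ l, (X : ℝ[X]) ^ d l • ((S l).toBlocks₂₂).map Polynomial.C).det).eval t * ((∑ l, (X : ℝ[X]) ^ d l • (S l).map Polynomial.C).det).eval t) ≤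
      ((((∑ l, (X : ℝ[X]) ^ d l • (S l).map Polynomial.C).updateRow (Sum.inl 0) (Pi.single (Sum.inl 0) 1 : Fin 2 ⊕ Fin s → ℝ[X])).det
        + ((∑ l, (X : ℝ[X]) ^ d l • (S l).map Polynomial.C).updateRow (Sum.inl 1) (Pi.single (Sum.inl 1) 1 : Fin 2 ⊕ Fin s → ℝ[X])).det).eval t) ^ 2 := by
  have hGt : ((∑ l, (X : ℝ[X]) ^ d l • (S l).map Polynomial.C).map (Polynomial.evalRingHom t)).IsSymm := (pencil_isSymm d S hS).map _
  have key := disc_nonneg_real _ hGt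
  have e1 : ((∑ l, (X : ℝ[X]) ^ d l • ((S l).toBlocks₂₂).map Polynomial.C).det).eval t = (((∑ l, (X : ℝ[X]) ^ d l • (S l).map Polynomial.C).map (Polynomial.evalRingHom t)).toBlocks₂₂).det := by
    rw [← toBlocks₂₂_pencil, ← Polynomial.coe_evalRingHom, RingHom.map_det, RingHom.mapMatrix_apply]; rfl
  have e2 : ((∑ l, (X : ℝ[X]) ^ d l • (S l).map Polynomial.C).det).eval t = ((∑ l, (X : ℝ[X]) ^ d l • (S l).map Polynomial.C).map (Polynomial.evalRingHom t)).det := by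
    rw [← Polynomial.coe_evalRingHom, RingHom.map_det, RingHom.mapMatrix_apply]
  have e3 : ∀ i : Fin 2 ⊕ Fin s, (((∑ l, (X : ℝ[X]) ^ d l • (S l).map Polynomial.C).updateRow i (Pi.single i 1 : Fin 2 ⊕ Fin s → ℝ[X])).det).eval t =
      (((∑ l, (X : ℝ[X]) ^ d l • (S l).map Polynomial.C).map (Polynomial.evalRingHom t)).updateRow i (Pi.single i 1 : Fin 2 ⊕ Fin s → ℝ)).det := by
    intro i
    rw [← Polynomial.coe_evalRingHom, RingHom.map_det, RingHom.mapMatrix_apply, Matrix.map_updateRow,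
      comp_single_one (map_zero _) (map_one _)]
  rw [eval_add, e1, e2, e3, e3]
  exact key

end pencilDisc

end OsculationRankTwo

end Summit.ValiantsHypothesis.ValiantsHypothesis.Theorems.LacunarySymmetroidMatrixDescartes
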